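import Mathlib

set_option autoImplicit false
set_option linter.dupNamespace false

/-!
# `𝒞₇` genus road (crux `EllipticUnitValueSevenOfGZK`, K7r), ROAD I input `hinv` — the generic lemma
# «a character of order prime to `7` is as non-trivial on a normal subgroup of index `7ⁿ` as on the whole group»,
# in Mathlib currency, with the «no fixed vector on the line» corollary (bsd-idea-20 g79; answer to pen D1076 (iii)(b) / D1080)

Crux workfile (NOT importable; lift the proofs verbatim).  Ideator seat bsd-idea-20 g79 (planner, claim-free, kit 0,
W-71/W-79).  Consumer: k-ty1 g31's L4b `Kato2004/KummerCupCoboundaryTest.lean`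
`forall_smul_eq_of_coresLe_kummerCupLevelClass_eq_zero`, hypothesis
`hinv : ∀ Q, (∀ u : U, u • g Q = g Q) → g Q = 0` («`(im g₁)^{Uₙ} = W₂[𝔭]^{Uₙ} = 0`»), to be discharged in L5/L6
(pen D1078 (a), D1080 «make it an explicit lemma of L5 or L6»).

## The mathematics (soundness of g78-R2 / D1076 (iii)(b), confirmed)
`Uₙ = Gal(K̄/Kℚₙ)` is NORMAL in `Γ_K = Gal(K̄/K)` of index `[Kℚₙ : K] = 7ⁿ` (`K = ℚ(√−7) ⊂ ℚ(μ₇)`, so `ℚₙ ∩ K = ℚ`).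
`Γ_K` acts on the line `W₂[𝔭] = im g₁ ≅ 𝔽₇` through a character `χ : Γ_K → 𝔽₇ˣ` (at the consumer: `χ = χ_D·ω⁵ = χ_D·ω⁻¹`,
the (H_η) letter), and `χ ≠ 1` (its order divides `6` and is `> 1`: `ω|_{Γ_K}` has order `3` because `ω³ = χ_{−7}`).
CLAIM: `χ|_{Uₙ} ≠ 1`, hence `W₂[𝔭]^{Uₙ} = 0`.  PROOF WITHOUT INDEX ARITHMETIC ON THE IMAGE: pick `σ` with `χ σ ≠ 1`;
`σ ^ [Γ_K : Uₙ] ∈ Uₙ` (`Subgroup.pow_index_mem`, normality), and `χ (σ ^ 7ⁿ) = (χ σ) ^ 7ⁿ = χ σ` because `x ^ 6 = 1` in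
`(ZMod 7)ˣ` (`ZMod.units_pow_card_sub_one_eq_one`) and `7ⁿ ≡ 1 (mod 6)`.  Then a `Uₙ`-fixed `P` on the line satisfies
`c • P = P` with `c ≢ 1 (mod 7)` and `7 • P = 0`, so `P = 0` (`(c − 1)` is invertible mod `7`).
The coprime-index form (any finite image) is §1; the `7ⁿ`-form the consumer needs is §2; the fixed-vector corollary is §3.

## Mathlib names used (the «generic lemma in Mathlib currency» asked for)
`Subgroup.index_map_dvd`, `Subgroup.index_dvd_card`, `Nat.Coprime.coprime_dvd_left`, `Nat.Coprime.eq_one_of_dvd`,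
`Subgroup.index_eq_one`, `MonoidHom.rangeRestrict_surjective` (§1); `Subgroup.pow_index_mem`,
`ZMod.units_pow_card_sub_one_eq_one`, `Nat.div_add_mod`, `pow_mul` (§2); `Int.ModEq`, `ZMod.intCast_eq_intCast_iff'`,
`ZMod.natCast_zmod_val` (§3).

HONEST LABEL: generic group/character lemmas (import Mathlib only); nothing about `W`, Kato's classes or the crux is
proved; (B2′) NOT proved; stmt-BirchSwinnertonDyer-19945 OPEN (4 sorries, zp v17); `X12.CMRamifiedSeven` NOT proved; no
summit statement is proved by this seat; BSD is claimed for no curve.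
-/

namespace Summit.BirchSwinnertonDyer.BirchSwinnertonDyer.Cruxes.EllipticUnitValueSevenOfGZK.CyclotomicLayerCharacter

open Subgroup

/-! ## §1 Coprime-index form (any homomorphism with finite image) -/

/-- If `H ≤ G` has index coprime to `Nat.card f.range`, then `f` maps `H` ONTO `f.range` (through `rangeRestrict`). -/
theorem map_rangeRestrict_eq_top_of_coprime_index {G M : Type*} [Group G] [Group M]
    (f : G →* M) (H : Subgroup G)
    (h : Nat.Coprime H.index (Nat.card f.range)) : H.map f.rangeRestrict = ⊤ := by
  have hs : Function.Surjective f.rangeRestrict := f.rangeRestrict_surjective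
  have h1 : (H.map f.rangeRestrict).index ∣ H.index := Subgroup.index_map_dvd H hs
  have h2 : (H.map f.rangeRestrict).index ∣ Nat.card f.range := Subgroup.index_dvd_card _
  exact Subgroup.index_eq_one.mp ((Nat.Coprime.coprime_dvd_left h1 h).eq_one_of_dvd h2)

/-- Element form: a homomorphism non-trivial on `G` is non-trivial on every subgroup whose index is coprime to the
order of the image. -/
theorem exists_mem_map_ne_one_of_coprime_index {G M : Type*} [Group G] [Group M]
    (f : G →* M) (H : Subgroup G)
    (h : Nat.Coprime H.index (Nat.card f.range)) {g : G} (hg : f g ≠ 1) :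
    ∃ x ∈ H, f x ≠ 1 := by
  have htop := map_rangeRestrict_eq_top_of_coprime_index f H h
  have hmem : f.rangeRestrict g ∈ H.map f.rangeRestrict := by rw [htop]; exact mem_top _
  obtain ⟨x, hxH, hx⟩ := Subgroup.mem_map.mp hmem
  refine ⟨x, hxH, ?_⟩
  intro hx1
  apply hg
  have : (f.rangeRestrict x : M) = f.rangeRestrict g := by rw [hx]
  simp only [MonoidHom.coe_rangeRestrict] at this
  rw [← this, hx1]

/-! ## §2 The form the consumer needs: index `7ⁿ`, values in `(ZMod 7)ˣ` -/

/-- For `U ⊴ Γ` of index `7ⁿ` and `χ : Γ →* (ZMod 7)ˣ` with `χ σ ≠ 1`: `σ ^ U.index ∈ U` and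
`χ (σ ^ 7ⁿ) = (χ σ) ^ 7ⁿ = χ σ ≠ 1` (`x ^ 6 = 1` in `(ZMod 7)ˣ`, `7ⁿ ≡ 1 (mod 6)`). -/
theorem exists_mem_ne_one_of_index_eq_seven_pow {Γ : Type*} [Group Γ] (U : Subgroup Γ)
    [U.Normal] (n : ℕ) (hU : U.index = 7 ^ n) (χ : Γ →* (ZMod 7)ˣ) {σ : Γ} (hσ : χ σ ≠ 1) :
    ∃ u ∈ U, χ u ≠ 1 := by
  haveI : Fact (Nat.Prime 7) := ⟨by norm_num⟩
  refine ⟨σ ^ U.index, Subgroup.pow_index_mem U σ, ?_⟩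
  rw [map_pow, hU]
  have h6 : (χ σ) ^ 6 = 1 := by
    simpa using ZMod.units_pow_card_sub_one_eq_one 7 (χ σ)
  have hmod : ∀ m : ℕ, 7 ^ m % 6 = 1 := by
    intro m
    induction m with
    | zero => rfl
    | succ k ih => rw [pow_succ, Nat.mul_mod, ih]
  rw [← Nat.div_add_mod (7 ^ n) 6, hmod n, pow_add, pow_one, pow_mul, h6, one_pow, one_mul]
  exact hσ

/-! ## §3 No fixed vector on the line -/

/-- Pure arithmetic: if `c • P = P`, `(c − 1)·d ≡ 1 [ZMOD n]` and `n • P = 0`, then `P = 0`. -/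
theorem eq_zero_of_smul_eq_self {V : Type*} [AddCommGroup V] (P : V) (n : ℕ) (hn : n • P = 0)
    (c d : ℤ) (hcd : (c - 1) * d ≡ 1 [ZMOD n]) (hP : c • P = P) : P = 0 := by
  have h1 : (c - 1) • P = 0 := by rw [sub_smul, one_smul, hP, sub_self]
  have h2 : ((c - 1) * d) • P = 0 := by rw [mul_comm, mul_smul, h1, smul_zero]
  obtain ⟨k, hk⟩ := (Int.ModEq.symm hcd).dvd
  have h3 : ((c - 1) * d) • P = P + (n * k : ℤ) • P := by
    rw [← hk, sub_smul, one_smul]; abel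
  have h4 : ((n : ℤ) * k) • P = 0 := by
    rw [mul_comm, mul_smul, natCast_zsmul, hn, smul_zero]
  rw [h3, h4, add_zero] at h2
  exact h2

/-- The `7`-torsion instance: an integer scalar `c ≢ 1 (mod 7)` fixes no non-zero `7`-torsion vector. -/
theorem eq_zero_of_smul_eq_self_seven {V : Type*} [AddCommGroup V] (P : V) (h7 : 7 • P = 0) (c : ℤ)
    (hc : ¬ (c : ZMod 7) = 1) (hP : c • P = P) : P = 0 := by
  have hne : ((c - 1 : ℤ) : ZMod 7) ≠ 0 := by
    intro h; apply hc
    have : ((c : ZMod 7) - 1) = 0 := by simpa using h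
    exact sub_eq_zero.mp this
  haveI : Fact (Nat.Prime 7) := ⟨by norm_num⟩
  obtain ⟨d, hd⟩ : ∃ d : ℤ, ((c - 1 : ℤ) : ZMod 7) * (d : ZMod 7) = 1 :=
    ⟨(((c - 1 : ℤ) : ZMod 7)⁻¹).val, by
      rw [ZMod.natCast_val, ZMod.intCast_cast, ZMod.cast_id', id, mul_inv_cancel₀ hne]⟩
  refine eq_zero_of_smul_eq_self P 7 h7 c d ?_ hP
  rw [Int.ModEq, ← ZMod.intCast_eq_intCast_iff']
  push_cast
  simpa using hd

/-- ★ **`(im g₁)^{Uₙ} = 0` in the abstract shape of L4b's `hinv`.**  `Γ` acts on the `7`-torsion vectors of `V` through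
any function `act` which on `7`-torsion vectors is the scalar `χ τ` (read as the integer `(χ τ).val`); `U ⊴ Γ` has index
`7ⁿ`; `χ σ ≠ 1` for some `σ`.  Then every `U`-fixed `7`-torsion vector is `0`. -/
theorem eq_zero_of_forall_mem_act_eq {Γ V : Type*} [Group Γ] [AddCommGroup V]
    (act : Γ → V → V) (χ : Γ →* (ZMod 7)ˣ)
    (hact : ∀ (τ : Γ) (P : V), 7 • P = 0 → act τ P = ((((χ τ : (ZMod 7)ˣ) : ZMod 7).val : ℕ) : ℤ) • P)
    (U : Subgroup Γ) [U.Normal] (n : ℕ) (hU : U.index = 7 ^ n) {σ : Γ} (hσ : χ σ ≠ 1)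
    (P : V) (h7 : 7 • P = 0) (hfix : ∀ u ∈ U, act u P = P) : P = 0 := by
  obtain ⟨u, huU, hu⟩ := exists_mem_ne_one_of_index_eq_seven_pow U n hU χ hσ
  have hP : ((((χ u : (ZMod 7)ˣ) : ZMod 7).val : ℕ) : ℤ) • P = P := by
    rw [← hact u P h7]; exact hfix u huU
  refine eq_zero_of_smul_eq_self_seven P h7 _ ?_ hP
  rw [Int.cast_natCast, ZMod.natCast_zmod_val]
  exact fun h => hu (Units.val_eq_one.mp h)

end Summit.BirchSwinnertonDyer.BirchSwinnertonDyer.Cruxes.EllipticUnitValueSevenOfGZK.CyclotomicLayerCharacter
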